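import Summits.ResolutionOfSingularities.ResolutionOfSingularities.Theorems.FrobeniusLadderFInjectiveMacaulayficationCIClassRowEqualSupport
import Summits.ResolutionOfSingularities.ResolutionOfSingularities.Theorems.FrobeniusLadderFInjectiveMacaulayficationDiagonalCIPair
import Summits.ResolutionOfSingularities.ResolutionOfSingularities.Theorems.FrobeniusLadderFInjectiveMacaulayficationDiagonalBPCIPrime
import HarnessLib

/-!
# (A5c) ★★★ THE FIRST NON-HYPERSURFACE F-SIDE CENSUS ROW: the diagonal Brieskorn–Pham complete-intersection SURFACE-PAIR bed
# `X = V(x₀²+x₁³+x₂³+x₃⁴+x₄⁵+x₅⁵, x₀²+2x₁³+3x₂³+4x₃⁴+5x₄⁵+6x₅⁵) ⊂ 𝔸⁶` (codimension 2, `char k = p ≥ 7`, `k` ANY field) — POINT FLOOR CURED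
# (crux `FInjectiveMacaulayfication` stmt-ResolutionOfSingularities-15315, chain w45a; res-L1-w45a-plan-1 RULING R23.3 (A5) «bed = the diagonal Brieskorn–Pham CI pair
# F₁ = Σ xᵢ^{aᵢ}, F₂ = Σ cᵢxᵢ^{aᵢ}, cᵢ pairwise distinct, p ∤ aᵢ — certified in-Lean»; seat res-L1-w45a-stub-2 g12)

[OURS · L1 W4.5a] Support file (`--supports stmt-ResolutionOfSingularities-15315 --as helper`); def-free; UNCONDITIONAL; no named fact, no sorry; NOT a statement of
any manuscript; replaces the role of NO printed item. Nothing of the crux is proved. AI-written (AI review weaker than expert review).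

★★★ `diagonalBPCI_pointFloorCured` — ONE application of the unconditional CI class theorem ✓ `CIClassRowEqualSupport.fHalfRow_CI_of_convenient_equalSupport` to the bed, all
class hypotheses CERTIFIED in the kernel: `(F₁, F₂)` PRIME (✓ `DiagonalBPCIPrime.isPrime_span_pair`, the monic-tower argument); equal supports, convenient, `x̄ᵥ ≠ 0`,
GEOMETRICALLY Khovanskii-non-degenerate along every positive weight, regular off the vertex (✓ `DiagonalCIPair.*`, exponents `2,3,3,4,5,5` and coefficient minors
`j − i` non-zero since `p ≥ 7`). CONCLUSION: for EVERY blowing up `S′ → Spec 𝒪_{X,0}` of the POINT FLOOR there is `𝓚 ≠ ⊥` on `S′`, co-supported over the closed point,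
ALL of whose blowings up are FULL (`FullCl p`) at EVERY stalk — the F-half of the crux's fibre clause, for a germ that is NOT a hypersurface (embedding dimension 6,
dimension 4). `k` is any field of characteristic `p ≥ 7`; `K ⊇ k` algebraically closed carries the geometric non-degeneracy.
[cite: IshiiSingularities2018, Thm. 4.4.23] [cite: CuetoPopescupampuStepanov2023, Def. 4.2 (p. 12)] [cite: StacksProject, Tag 080A]
-/

-- single-problem summit: the doubled namespace component is forced
set_option linter.dupNamespace false

noncomputable section

open AlgebraicGeometry CategoryTheory Literature.AlgebraicGeometry.Resolution TopologicalSpace IsLocalRing MvPolynomial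

namespace Summit.ResolutionOfSingularities.ResolutionOfSingularities.Theorems.FInjectiveMacaulayfication.DiagonalBPCIRow

open Summit.ResolutionOfSingularities.ResolutionOfSingularities.Theorems.FInjectiveMacaulayfication
open Literature.AlgebraicGeometry.Resolution.BoubakriGreuelMarkwig CINondegenerate SliceableCentre

/-! ## §1 Casts in characteristic `p ≥ 7`; the bed in `Σ`-form -/

/-- `(m : R) ≠ 0` for `0 < m < p` in characteristic `p`. [folklore] -/
theorem natCast_ne_zero_of_lt {R : Type} [AddMonoidWithOne R] (p : ℕ) [CharP R p] (m : ℕ) (hm : 0 < m) (hmp : m < p) : (m : R) ≠ 0 :=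
  fun h => Nat.not_dvd_of_pos_of_lt hm hmp ((CharP.cast_eq_zero_iff R p m).mp h)

/-- The exponent vector `(2, 3, 3, 4, 5, 5)`: entries `≥ 2`, `≤ 5`. [plumbing] -/
theorem two_le_a_le (i : Fin 6) : 2 ≤ (![2, 3, 3, 4, 5, 5] : Fin 6 → ℕ) i ∧ (![2, 3, 3, 4, 5, 5] : Fin 6 → ℕ) i ≤ 5 := by
  fin_cases i <;> simp

/-- `F₁ = Σ xᵢ^{aᵢ}` in `Σ`-form. [plumbing] -/
theorem F0_eq_sum (k : Type) [Field k] :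
    (X 0 ^ 2 + X 1 ^ 3 + X 2 ^ 3 + X 3 ^ 4 + X 4 ^ 5 + X 5 ^ 5 : MvPolynomial (Fin 6) k) =
      ∑ i : Fin 6, monomial (Finsupp.single i ((![2, 3, 3, 4, 5, 5] : Fin 6 → ℕ) i)) ((fun _ : Fin 6 => (1 : k)) i) := by
  simp only [Fin.sum_univ_six, Matrix.cons_val_zero, Matrix.cons_val_one, Matrix.cons_val, X_pow_eq_monomial]

/-- `F₂ = Σ (i+1)·xᵢ^{aᵢ}` in `Σ`-form. [plumbing] -/
theorem F1_eq_sum (k : Type) [Field k] :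
    (X 0 ^ 2 + C 2 * X 1 ^ 3 + C 3 * X 2 ^ 3 + C 4 * X 3 ^ 4 + C 5 * X 4 ^ 5 + C 6 * X 5 ^ 5 : MvPolynomial (Fin 6) k) =
      ∑ i : Fin 6, monomial (Finsupp.single i ((![2, 3, 3, 4, 5, 5] : Fin 6 → ℕ) i)) ((fun i : Fin 6 => (((i : ℕ) + 1 : ℕ) : k)) i) := by
  simp only [Fin.sum_univ_six, Matrix.cons_val_zero, Matrix.cons_val_one, Matrix.cons_val, ← C_mul_X_pow_eq_monomial]
  norm_num

/-! ## §2 ★★★ The row -/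

set_option maxHeartbeats 800000 in
-- the interface of the class theorem is large; the certificates are assembled in one term
/-- ★★★ **THE DIAGONAL BRIESKORN–PHAM CI PAIR `(x₀²+x₁³+x₂³+x₃⁴+x₄⁵+x₅⁵, x₀²+2x₁³+3x₂³+4x₃⁴+5x₄⁵+6x₅⁵)`, `char k = p ≥ 7`, `k` ANY FIELD: POINT FLOOR CURED** — the first
F-side census row on a NON-HYPERSURFACE germ. See the module docstring. [OURS · census row over the unconditional CI class theorem; cite: IshiiSingularities2018, Thm. 4.4.23;
CuetoPopescupampuStepanov2023, Def. 4.2; StacksProject, Tag 080A] -/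
theorem diagonalBPCI_pointFloorCured (p : ℕ) [Fact p.Prime] (hp : 7 ≤ p) (k : Type) [Field k] [CharP k p] (K : Type) [Field K] [Algebra k K] [IsAlgClosed K]
    (F : Fin 2 → MvPolynomial (Fin 6) k)
    (hF0 : F 0 = X 0 ^ 2 + X 1 ^ 3 + X 2 ^ 3 + X 3 ^ 4 + X 4 ^ 5 + X 5 ^ 5)
    (hF1 : F 1 = X 0 ^ 2 + C 2 * X 1 ^ 3 + C 3 * X 2 ^ 3 + C 4 * X 3 ^ 4 + C 5 * X 4 ^ 5 + C 6 * X 5 ^ 5)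
    (v : Spec (.of (MvPolynomial (Fin 6) k ⧸ Ideal.span (Set.range F))))
    (hvm : v.asIdeal = Ideal.span (Set.range fun j : Fin 6 => Ideal.Quotient.mk (Ideal.span (Set.range F)) (X j))) :
    ∀ (S' : Scheme.{0}) (gS : S' ⟶ Spec ((Spec (.of (MvPolynomial (Fin 6) k ⧸ Ideal.span (Set.range F)))).presheaf.stalk v)),
      IsBlowup gS ((affineBlowup.idealSheaf (Ideal.span (Set.range fun j : Fin 6 => Ideal.Quotient.mk (Ideal.span (Set.range F)) (X j)))).comap
        ((Spec (.of (MvPolynomial (Fin 6) k ⧸ Ideal.span (Set.range F)))).fromSpecStalk v)) →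
      ∃ 𝓚 : S'.IdealSheafData, 𝓚 ≠ ⊥ ∧
        (∀ s ∈ (𝓚.support : Set S'), gS.base s = closedPoint ((Spec (.of (MvPolynomial (Fin 6) k ⧸ Ideal.span (Set.range F)))).presheaf.stalk v)) ∧
        ∀ (S'' : Scheme.{0}) (π : S'' ⟶ S'), IsBlowup π 𝓚 → ∀ s : S'', FullCl p (S''.presheaf.stalk s) := by
  classical
  haveI : CharP K p := charP_of_injective_algebraMap (algebraMap k K).injective p
  -- casts: `1, …, 6 ≠ 0` in `k` and `K`
  have hk : ∀ m : ℕ, 0 < m → m ≤ 6 → (m : k) ≠ 0 := fun m hm hm6 => natCast_ne_zero_of_lt p m hm (by omega)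
  have hK : ∀ m : ℕ, 0 < m → m ≤ 6 → (m : K) ≠ 0 := fun m hm hm6 => natCast_ne_zero_of_lt p m hm (by omega)
  -- the data of the diagonal pair
  set a : Fin 6 → ℕ := ![2, 3, 3, 4, 5, 5] with ha_def
  have ha : ∀ i, a i ≠ 0 := fun i => by have := (two_le_a_le i).1; rw [← ha_def] at this; omega
  have ha2 : ∀ i, 2 ≤ a i := fun i => by have := (two_le_a_le i).1; rwa [← ha_def] at this
  have hak : ∀ i, ((a i : ℕ) : k) ≠ 0 := fun i => hk (a i) (Nat.pos_of_ne_zero (ha i)) (by have := (two_le_a_le i).2; rw [← ha_def] at this; omega)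
  have haK : ∀ i, ((a i : ℕ) : K) ≠ 0 := fun i => hK (a i) (Nat.pos_of_ne_zero (ha i)) (by have := (two_le_a_le i).2; rw [← ha_def] at this; omega)
  have hF0' : F 0 = ∑ i : Fin 6, monomial (Finsupp.single i (a i)) ((fun _ : Fin 6 => (1 : k)) i) := by rw [hF0, F0_eq_sum]
  have hF1' : F 1 = ∑ i : Fin 6, monomial (Finsupp.single i (a i)) ((fun i : Fin 6 => (((i : ℕ) + 1 : ℕ) : k)) i) := by rw [hF1, F1_eq_sum]
  have hc : ∀ i : Fin 6, (fun _ : Fin 6 => (1 : k)) i ≠ 0 := fun _ => one_ne_zero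
  have hc' : ∀ i : Fin 6, (fun i : Fin 6 => (((i : ℕ) + 1 : ℕ) : k)) i ≠ 0 := fun i => hk _ (Nat.succ_pos _) (by have := i.2; omega)
  have hcK : ∀ i : Fin 6, (fun _ : Fin 6 => (1 : K)) i ≠ 0 := fun _ => one_ne_zero
  have hc'K : ∀ i : Fin 6, (fun i : Fin 6 => (((i : ℕ) + 1 : ℕ) : K)) i ≠ 0 := fun i => hK _ (Nat.succ_pos _) (by have := i.2; omega)
  -- the coefficient minors `c_i c'_j − c_j c'_i = (j+1) − (i+1) ≠ 0` for `i ≠ j` (casts are injective below `p`)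
  have hminor : ∀ i j : Fin 6, i ≠ j → (fun _ : Fin 6 => (1 : k)) i * (fun i : Fin 6 => (((i : ℕ) + 1 : ℕ) : k)) j ≠
      (fun _ : Fin 6 => (1 : k)) j * (fun i : Fin 6 => (((i : ℕ) + 1 : ℕ) : k)) i := by
    intro i j hij h
    simp only [one_mul] at h
    have := CharP.natCast_injOn_Iio k p (by have := j.2; simp only [Set.mem_Iio]; omega) (by have := i.2; simp only [Set.mem_Iio]; omega) h
    exact hij (Fin.ext (by omega))
  have hminorK : ∀ i j : Fin 6, i ≠ j → (fun _ : Fin 6 => (1 : K)) i * (fun i : Fin 6 => (((i : ℕ) + 1 : ℕ) : K)) j ≠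
      (fun _ : Fin 6 => (1 : K)) j * (fun i : Fin 6 => (((i : ℕ) + 1 : ℕ) : K)) i := by
    intro i j hij h
    simp only [one_mul] at h
    have := CharP.natCast_injOn_Iio K p (by have := j.2; simp only [Set.mem_Iio]; omega) (by have := i.2; simp only [Set.mem_Iio]; omega) h
    exact hij (Fin.ext (by omega))
  -- base change of the pair to `K`
  have hmap0 : map (algebraMap k K) (F 0) = ∑ i : Fin 6, monomial (Finsupp.single i (a i)) ((fun _ : Fin 6 => (1 : K)) i) := by
    rw [hF0', DiagonalCIPair.map_diag]
    simp only [map_one]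
  have hmap1 : map (algebraMap k K) (F 1) = ∑ i : Fin 6, monomial (Finsupp.single i (a i)) ((fun i : Fin 6 => (((i : ℕ) + 1 : ℕ) : K)) i) := by
    rw [hF1', DiagonalCIPair.map_diag]
    simp only [map_natCast]
  -- the class hypotheses
  have hprime : (Ideal.span (Set.range F)).IsPrime :=
    DiagonalBPCIPrime.isPrime_span_pair k (by exact_mod_cast hk 3 (by norm_num) (by norm_num)) (by exact_mod_cast hk 4 (by norm_num) (by norm_num)) F hF0 hF1
  have hconv : ∀ j : Fin 6, ∃ N : ℕ, 0 < N ∧ MvPolynomial.coeff (Finsupp.single j N) (F 0) ≠ 0 := by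
    rw [hF0']; exact DiagonalCIPair.convenient_diag a ha _ hc
  have hsupp : ∀ l : Fin 2, (F l).support = (F 0).support :=
    Fin.forall_fin_two.mpr ⟨rfl, by rw [hF1', hF0']; exact DiagonalCIPair.support_diag_eq a ha _ _ hc hc'⟩
  have hND : ∀ w : Fin 6 → ℝ, (∀ i, 0 < w i) →
      IsCINondegenerateAlong w (fun l => ((map (algebraMap k K) (F l) : MvPolynomial (Fin 6) K) : MvPowerSeries (Fin 6) K)) :=
    DiagonalCIPair.ciNondegenerate_pair (by norm_num) a ha haK _ _ hcK hc'K hminorK (fun l => map (algebraMap k K) (F l)) hmap0 hmap1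
  have hXne : ∀ v : Fin 6, Ideal.Quotient.mk (Ideal.span (Set.range F)) (X v) ≠ 0 := DiagonalCIPair.mk_X_ne_zero_pair a ha2 _ _ F hF0' hF1'
  have hreg : ∀ x : Spec (.of (MvPolynomial (Fin 6) k ⧸ Ideal.span (Set.range F))),
      ¬ Ideal.span (Set.range fun j : Fin 6 => Ideal.Quotient.mk (Ideal.span (Set.range F)) (X j)) ≤ x.asIdeal →
        IsRegularLocalRing (Localization.AtPrime x.asIdeal) :=
    fun x hx => DiagonalCIPair.isRegularLocalRing_off_vertex_pair p a ha hak _ _ hc hminor F hF0' hF1' x.asIdeal hx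
  exact CIClassRowEqualSupport.fHalfRow_CI_of_convenient_equalSupport p k K (by norm_num) F hprime 0 hconv hsupp hND hXne hreg v hvm

end Summit.ResolutionOfSingularities.ResolutionOfSingularities.Theorems.FInjectiveMacaulayfication.DiagonalBPCIRow

end
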